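import Mathlib
import HarnessLib

/-!
# Route `PrimeLevelFamEdge`, crux K_B `BeyondDiagonalBeatsQuarter` (stmt-Parity-20343), line
# `diagonal_kernel_split` (rev 2a): **F2 — the plan-Ω EXPONENT WINDOW is non-empty**

Lead `ls-Bfam-prover-1` g9 (2026-08-28), first target of record (ls-lead WORDS #1 09:32:13Z, director-frontier
K-PLFE-W2 10:29:11Z): «ONE admissible exponent tuple as a Lean lemma». Sources transcribed (desk documents of
this crux, `Cruxes/BeyondDiagonalBeatsQuarter/`): `GATE-G2-shape-ledger.md` sha16 85f607981fe5252d (planner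
ls-Bfam-plan g8: pieces a0–a8 of the block gap after Petersson → Kloosterman → double Poisson →
s-parametrisation → divisor switch, with ranges and homes; §(b) exponent ledger; §(c) the Ω-f dictionary onto
`Literature.NumberTheory.Sieve.AssingBlomerLi2020_proposition41`; §(d) Ω-g) and
`STUB-PLAN-stub_kernelDiagonalUpperOnPrimeAverageXSq.md` §4.3 (the resonance budget at an `(a₀, η′)`-clean
scale). Notation: `Δ′ ∈ (1, 2)` the mollifier length exponent (`M = q̂^{Δ′}`), `η = Δ′ − 1`, `x = N` the size
of the prime level, `κ₀ ∈ [½, 1]` the enhancement exponent of the bulk a8 (trivial size `N^{κ₀η+ε}·Σms`),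
`U` the tolerance of the registered heart `stub_kernelExcessBelowSlack_io` (`U < 4(Δ′−1)/Δ′`, the band slack).

WHAT THIS FILE IS. The ledger's rows are inequalities between OUR exponents
`(a₀, ηV, Δ′, U, ε, ε₁, σ, δ, η′)` and the PRINTED constants of the theorem-type homes — `ηA` and
`δ_ABL(ηV)` of ABL Prop. 4.1 (`∃ η₀ > 0 ∀ ηV ∈ (0, η₀] ∃ δ > 0 …`, typed, unproved), the clean-scale bound
`η₀(a₀)` HANDED to the analyst by `cleanScales_io` (`= c′₀/a₀`, Landau–Page, PROVED in `CleanScales.lean`),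
the log-free zero-density convergence bound `ηZ = c/(4C₂)` (§4.3 (ii)), and the resonance damping pair
`(C_R, c_R)` (§4.3: resonance `≤ η·C_R·e^{−c_R a₀}·Σms` at a clean scale). None of these constants is a
numeral in print (ABL's `δ(η)` is ineffective as stated; `c′₀` is effective but untyped), so «one admissible
tuple» can only mean: a tuple of EXPLICIT RATIONAL EXPRESSIONS in the constants that satisfies every row for
EVERY positive value of the constants, in the quantifier order the composition lemma
`kernelExcessBelowSlack_io_of_blockAtCleanScales` (CleanScales.lean) imposes —
`∃ a₀ ∀ η₀ ∃ b ∀ Δ′ ∈ (1,b) ∃ U ∃ η′ < η₀ …`. That is `omegaWindow_nonempty` below (witnesses: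
`ηV = min ηA 1/16`, `a₀ = 2C_R/c_R`, `b = 1 + m/4` with `m = min(δ_ABL(ηV), η₀, ηZ, 1/100)`, and on the window
`U = 2η`, `ε = m/16`, `ε₁ = σ = m`, `δ = m/2`, `η′ = 3m/4`). `omegaAdmissible_specimen` is the same system at
SPECIMEN (placeholder) constants, closed by `norm_num` — the literal rational tuple the order of record asks for.

WHAT F2 CAN AND CANNOT DETECT. It cannot certify that the ledger is analytically complete (that is the
content of the Ω-f/Ω-g helpers to come); it CAN detect emptiness by quantifier order. There is exactly one
such mechanism in this ledger and it is recorded as a theorem: the resonance row is proportional to `η`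
(§4.3: each near-1 zero contributes `≤ 8η·e^{−c2^j a₀}`, because the full-bias exceptional excess is
`8(Δ′−c₀)/Δ′² ≤ 8η` for conductor exponent `c₀ ≥ 1` — `KMV2000.excSecondTable_X_sq`); WERE it η-free
(`C·e^{−c a₀}` absolute) then with `a₀` chosen before the window — as the composition lemma has it — the
tolerance row is EMPTY (`omega_resonanceRow_empty_of_absolute`: `U → 0` as `Δ′ → 1⁺` but the floor does not),
while with `a₀ = a₀(Δ′)` inside the window it is again solvable jointly with the clean-scale coupling
`η + ε ≤ δ ≤ η′ < c′₀/a₀` (`omega_resonanceRow_nonempty_pointwise`, window `η < (c·c′₀)²/(32C)`): in that case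
the composition must be re-cut with `a₀` after `Δ′` (a 10-line variant of the CleanScales lemma), nothing
else changes. VERDICT F2: PASS (window non-empty; binding row = ABL's `a₁`-range `η + ε ≤ δ_ABL(ηV)`, as G2
§(c) predicted; no loss exponent fails to vanish with `η`).

Nothing here is analytic: no moment, no L-function, no dispersion statement is asserted; the rows are the
planner's ledger made checkable, and the theorem says they do not contradict each other. Standard axioms.
«The programme SEARCHES and TYPES; no claim about Landau–Siegel zeros, Theorems 1–2 of arXiv:2211.02515 or
a repaired Margin232 until a kernel theorem says so.»
-/

namespace Summit.Parity.GeneralizedHardyLittlewood.Theorems.BeyondDiagonalBeatsQuarter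

/-- **The plan-Ω exponent ledger (GATE G2 §(a)–(d) + STUB-PLAN §4.3), one field per row.**
Parameters, in order: the printed constants `ηA` (ABL Prop. 4.1's `η₀`), `δA` (`= δ_ABL(ηV)`), `η₀` (the
clean-scale bound handed over by `cleanScales_io`), `ηZ` (log-free density convergence), `CR`, `cR`
(resonance damping); then our tuple `a₀` (danger threshold of the clean scales), `ηV` (ABL's type-II
parameter), `Δ′` (length exponent), `κ₀` (bulk enhancement exponent, adversarial in `[½,1]`), `U` (tolerance),
`ε` (sum of the `N^{ε}`-losses: Mellin separation, dyadic boxes, strata), `ε₁` (c-tail cut `c > C₀N^{ε₁}`),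
`σ` (hand-over point `x^{1/2−σ}` between H7′ and ABL), `δ` (Drappeau kernel / conductor cut `R = N^{δ}`),
`η′` (clean-scale conductor exponent). [cite: AssingBlomerLi2020, Proposition 4.1 p. 17 (ranges `Q ≤ x^{1/2+δ}`, `|a₁| ≤ x^{1+δ}`, `|a₂|, R ≤ x^{δ}`, `x^{η} ≤ N ≤ x^{1/4+η}`)] -/
structure OmegaAdmissible (ηA δA η₀ ηZ CR cR a₀ ηV Δ' κ₀ U ε ε₁ σ δ η' : ℝ) : Prop where
  /-- window: `1 < Δ′` (beyond the diagonal). -/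
  one_lt : 1 < Δ'
  /-- window: `Δ′ < 2` (a1: Hecke `d`-extraction has `ε_q(d) = 1` since `mᵢ ≤ M < q`; H1 `cornerNegligibleXSq`
  is stated for `1 < Δ′ < 2`). -/
  lt_two : Δ' < 2
  /-- a7 (G1 §4 (iv)): short-interval Möbius exponent `θ = 1 − η/(1+η) = 1/Δ′ > 7/12`. -/
  moebius_short : 7 / 12 < 1 / Δ'
  /-- the danger threshold of the clean scales is positive (`cleanScales_io` needs `0 < a₀`). -/
  a₀_pos : 0 < a₀
  /-- heart: the tolerance sits strictly below the band slack `4(Δ′−1)/Δ′`. -/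
  slack : U < 4 * (Δ' - 1) / Δ'
  /-- Ω-g, STUB-PLAN §4.3: at an `(a₀, η′)`-clean scale the near-1 spectrum (resonance) is
  `≤ η·C_R·e^{−c_R a₀}·Σms`; it must sit STRICTLY inside `U` (the remainder of `U` absorbs the `o(Σms)` pieces
  a0, a3, a4, a7, a8R, a8P, each eventually below any positive multiple of `Σms`). -/
  resonance : (Δ' - 1) * (CR * Real.exp (-(cR * a₀))) < U
  /-- the accumulated `N^{ε}` loss is a genuine positive exponent. -/
  ε_pos : 0 < ε
  /-- a4 (c-tail `c > C₀N^{ε₁}`, `J₁(x) ≤ x/2`): `N^{κ₀η + ε − ε₁} = o(1)`. -/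
  ctail : κ₀ * (Δ' - 1) + ε < ε₁
  /-- Ω-f dictionary, moduli: `d′ ≤ N^{1/2+η/2+ε} ≤ x^{1/2+δ_ABL}`. -/
  abl_moduli : (Δ' - 1) / 2 + ε ≤ δA
  /-- Ω-f dictionary, shifts (BINDING): `|a₁| = A ≤ N^{1+η+ε} ≤ x^{1+δ_ABL}` and `a₂ = cs ≤ N^{η+ε} ≤ x^{δ_ABL}`. -/
  abl_shift : (Δ' - 1) + ε ≤ δA
  /-- the conductor cut / Drappeau kernel parameter `R = N^{δ}` is a genuine power. -/
  δ_pos : 0 < δ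
  /-- Ω-f dictionary, kernel: `R = N^{δ} ≤ x^{δ_ABL}`. -/
  abl_R : δ ≤ δA
  /-- a8R: the dispersion saving `R^{−1} = N^{−δ}` beats the bulk `N^{κ₀η+ε}`. -/
  saving : κ₀ * (Δ' - 1) + ε < δ
  /-- H7′ hand-over point is a genuine exponent below `1/2`. -/
  σ_pos : 0 < σ
  /-- H7′: `x^{1/2−σ} < x^{1/2}`. -/
  σ_lt : σ < 1 / 2
  /-- H7′ (`vaughan_meanValue` + `largeSieve_character_tail`, conductors in `(R, x^{1/2−σ}]`): the saving
  `min(N^{δ}, N^{1/6}, N^{σ})` beats the bulk — the `1/6` branch. (Redundant if ABL 4.1 is applied to all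
  moduli `≥ 1`; recorded because G2 §(b) books it.) -/
  vaughan_sixth : κ₀ * (Δ' - 1) + ε < 1 / 6
  /-- H7′: the `σ` branch of the same saving. -/
  vaughan_σ : κ₀ * (Δ' - 1) + ε < σ
  /-- type II: ABL's bilinear parameter is positive … -/
  ηV_pos : 0 < ηV
  /-- … and inside ABL's admissible range `(0, ηA]` (so that `δA = δ_ABL(ηV) > 0` is supplied). -/
  ηV_le : ηV ≤ ηA
  /-- type I companion (G2 §(c)): the long smooth variable `≥ x^{3/4−ηV}` exceeds the modulus
  `N^{1/2+η/2+ε}` by a further `N^{ε}` (Poisson + Ramanujan/Weil). -/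
  typeI : ηV + (Δ' - 1) / 2 + 2 * ε < 1 / 4
  /-- clean-scale conductor exponent is positive (`cleanScales_io` needs `0 < η′`). -/
  η'_pos : 0 < η'
  /-- a8S: every conductor `≤ R = N^{δ}` is covered by `(a₀, η′)`-cleanliness (`CleanScale a₀ η′ N` speaks of
  conductors `≤ N^{η′}`). -/
  R_le_clean : δ ≤ η'
  /-- clean scales recur only for `η′ < η₀(a₀)` (`cleanScales_io`, Landau–Page). -/
  clean_window : η' < η₀
  /-- §4.3 (ii): geometric convergence of the zero count against the damping, `η′ < ηZ = c/(4C₂)`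
  (log-free zero density). -/
  density : η' < ηZ

/-- **F2: the plan-Ω exponent window is NON-EMPTY, for every positive value of the printed constants, in the
quantifier order of `kernelExcessBelowSlack_io_of_blockAtCleanScales`** (`a₀` absolute, then ANY handed `η₀ > 0`,
then the window `b`, then every `Δ′ ∈ (1, b)` and — adversarially — every bulk exponent `κ₀ ∈ [½, 1]`).
Witnesses (explicit rational expressions): `ηV = min ηA (1/16)`, `a₀ = 2C_R/c_R`,
`m = min (min δA η₀) (min ηZ (1/100))`, `b = 1 + m/4`; on the window `U = 2(Δ′−1)`, `ε = m/16`, `ε₁ = σ = m`,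
`δ = m/2`, `η′ = 3m/4`. The binding row is `abl_shift` (`η + ε ≤ δ_ABL(ηV)`), as G2 §(c) says; no loss exponent
fails to vanish with `η`, so the window cannot be empty — only small (`b − 1 = m/4`).
[cite: AssingBlomerLi2020, Proposition 4.1 p. 17; MontgomeryVaughan2007, Cor. 11.10 (Page)] -/
theorem omegaWindow_nonempty {ηA ηZ CR cR : ℝ} (hηA : 0 < ηA) (hηZ : 0 < ηZ) (hCR : 0 < CR)
    (hcR : 0 < cR) {δABL : ℝ → ℝ} (hδABL : ∀ ηV : ℝ, 0 < ηV → ηV ≤ ηA → 0 < δABL ηV) :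
    ∃ ηV : ℝ, 0 < ηV ∧ ηV ≤ ηA ∧ ∃ a₀ : ℝ, 0 < a₀ ∧ ∀ η₀ : ℝ, 0 < η₀ →
      ∃ b : ℝ, 1 < b ∧ b < 2 ∧ ∀ Δ' : ℝ, 1 < Δ' → Δ' < b → ∀ κ₀ : ℝ, 1 / 2 ≤ κ₀ → κ₀ ≤ 1 →
        ∃ U ε ε₁ σ δ η' : ℝ,
          OmegaAdmissible ηA (δABL ηV) η₀ ηZ CR cR a₀ ηV Δ' κ₀ U ε ε₁ σ δ η' := by
  -- type II parameter first (δ_ABL depends on it)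
  set ηV : ℝ := min ηA (1 / 16) with hηV_def
  have hηV_pos : 0 < ηV := lt_min hηA (by norm_num)
  have hηV_le : ηV ≤ ηA := min_le_left _ _
  have hηV_16 : ηV ≤ 1 / 16 := min_le_right _ _
  have hδA : 0 < δABL ηV := hδABL ηV hηV_pos hηV_le
  -- absolute danger threshold: C_R e^{-2 C_R} < 1
  set a₀ : ℝ := 2 * CR / cR with ha₀_def
  have ha₀_pos : 0 < a₀ := by positivity
  have hdamp : CR * Real.exp (-(cR * a₀)) < 1 := by
    have hca : cR * a₀ = 2 * CR := by rw [ha₀_def]; field_simp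
    rw [hca]
    have h1 : 2 * CR + 1 ≤ Real.exp (2 * CR) := by
      have := Real.add_one_le_exp (2 * CR); linarith
    have hprod : Real.exp (-(2 * CR)) * (2 * CR + 1) ≤ 1 := by
      calc Real.exp (-(2 * CR)) * (2 * CR + 1)
          ≤ Real.exp (-(2 * CR)) * Real.exp (2 * CR) :=
            mul_le_mul_of_nonneg_left h1 (Real.exp_pos _).le
        _ = 1 := by rw [← Real.exp_add]; simp
    nlinarith [Real.exp_pos (-(2 * CR)), hprod, hCR]
  refine ⟨ηV, hηV_pos, hηV_le, a₀, ha₀_pos, fun η₀ hη₀ ↦ ?_⟩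
  -- the budget m and the window b = 1 + m/4
  set m : ℝ := min (min (δABL ηV) η₀) (min ηZ (1 / 100)) with hm_def
  have hm_pos : 0 < m := lt_min (lt_min hδA hη₀) (lt_min hηZ (by norm_num))
  have hm_δA : m ≤ δABL ηV := (min_le_left _ _).trans (min_le_left _ _)
  have hm_η₀ : m ≤ η₀ := (min_le_left _ _).trans (min_le_right _ _)
  have hm_ηZ : m ≤ ηZ := (min_le_right _ _).trans (min_le_left _ _)
  have hm_100 : m ≤ 1 / 100 := (min_le_right _ _).trans (min_le_right _ _)
  refine ⟨1 + m / 4, by linarith, by linarith, fun Δ' h1 h2 κ₀ hκ₁ hκ₂ ↦ ?_⟩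
  have hη : 0 < Δ' - 1 := by linarith
  have hηm : Δ' - 1 < m / 4 := by linarith
  have hκη : κ₀ * (Δ' - 1) ≤ Δ' - 1 := by nlinarith
  have hκη' : κ₀ * (Δ' - 1) + m / 16 < 5 * m / 16 := by linarith
  refine ⟨2 * (Δ' - 1), m / 16, m, m, m / 2, 3 * m / 4, ?_⟩
  constructor
  · exact h1
  · linarith
  · rw [lt_div_iff₀ (by linarith)]; linarith
  · exact ha₀_pos
  · rw [lt_div_iff₀ (by linarith)]; nlinarith
  · have := mul_lt_mul_of_pos_left (show CR * Real.exp (-(cR * a₀)) < 2 by linarith) hη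
    linarith
  · positivity
  · linarith
  · linarith
  · linarith
  · positivity
  · linarith
  · linarith
  · positivity
  · linarith
  · linarith
  · linarith
  · exact hηV_pos
  · exact hηV_le
  · linarith
  · positivity
  · linarith
  · linarith
  · linarith

/-- **The one emptiness mechanism, recorded.** If the resonance bound were η-FREE — an absolute
`C·e^{−c·a₀}·Σms` with no factor `η = Δ′ − 1` — then with `a₀` (hence the floor) fixed BEFORE the window, as in
`kernelExcessBelowSlack_io_of_blockAtCleanScales`, no window `b` works: the slack `4(Δ′−1)/Δ′ → 0` as
`Δ′ → 1⁺` while the floor does not. So the `η`-proportionality of STUB-PLAN §4.3 (each near-1 zero weighs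
`≤ 8η·e^{−c2^j a₀}` since the full-bias excess is `8(Δ′−c₀)/Δ′² ≤ 8η` for `c₀ ≥ 1`,
`KMV2000.excSecondTable_X_sq`) is LOAD-BEARING for that quantifier order.
[cite: KowalskiMichelVanderKam2000, Thm. 6.1 (32) (the two-term main form the excess corrects)] -/
theorem omega_resonanceRow_empty_of_absolute {C c : ℝ} (hC : 0 < C) :
    ¬ ∃ a₀ b : ℝ, 1 < b ∧ ∀ Δ' : ℝ, 1 < Δ' → Δ' < b →
      ∃ U : ℝ, C * Real.exp (-(c * a₀)) < U ∧ U < 4 * (Δ' - 1) / Δ' := by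
  rintro ⟨a₀, b, hb, h⟩
  set r : ℝ := C * Real.exp (-(c * a₀)) with hr_def
  have hr : 0 < r := by positivity
  set t : ℝ := min ((b - 1) / 2) (r / 8) with ht_def
  have ht_pos : 0 < t := lt_min (by linarith) (by positivity)
  have ht_b : t ≤ (b - 1) / 2 := min_le_left _ _
  have ht_r : t ≤ r / 8 := min_le_right _ _
  obtain ⟨U, hU₁, hU₂⟩ := h (1 + t) (by linarith) (by linarith)
  have hslack : 4 * (1 + t - 1) / (1 + t) < r := by
    rw [div_lt_iff₀ (by linarith)]; nlinarith
  linarith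

/-- **… and its repair if ever needed.** With an η-free resonance floor `C·e^{−c·a₀}` the rows are still
jointly solvable when `a₀` may depend on `Δ′` (composition re-cut with `a₀` inside the window): on
`η = Δ′ − 1 < min(1/2, (c·c′₀)²/(32C))` take `a₀ = c′₀/(4η)` (so the clean-scale bound `c′₀/a₀ = 4η`),
`U = 2η`, `ε = η/2`, `δ = 2η`, `η′ = 3η`; the floor is `≤ 2C/(c a₀)² = 32Cη²/(c c′₀)² < η < U` by
`y²/2 ≤ e^{y}`. Only the coupled rows (tolerance, resonance, clean-scale chain `η + ε ≤ δ ≤ η′ < c′₀/a₀`) are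
displayed; the remaining rows of `OmegaAdmissible` do not involve `a₀`.
[cite: MontgomeryVaughan2007, Cor. 11.10 (Page: the level bound `c′₀/a₀`)] -/
theorem omega_resonanceRow_nonempty_pointwise {C c cLP : ℝ} (hC : 0 < C) (hc : 0 < c) (hcLP : 0 < cLP) :
    ∃ b : ℝ, 1 < b ∧ ∀ Δ' : ℝ, 1 < Δ' → Δ' < b →
      ∃ a₀ U ε δ η' : ℝ, 0 < a₀ ∧ 0 < ε ∧
        C * Real.exp (-(c * a₀)) < U ∧ U < 4 * (Δ' - 1) / Δ' ∧
        (Δ' - 1) + ε ≤ δ ∧ δ ≤ η' ∧ η' < cLP / a₀ := by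
  set K : ℝ := (c * cLP) ^ 2 with hK_def
  have hK : 0 < K := by positivity
  refine ⟨1 + min (1 / 2) (K / (32 * C)), ?_, fun Δ' h1 h2 ↦ ?_⟩
  · have := lt_min (by norm_num : (0 : ℝ) < 1 / 2) (by positivity : 0 < K / (32 * C))
    linarith
  set η : ℝ := Δ' - 1 with hη_def
  have hη : 0 < η := by rw [hη_def]; linarith
  have hη₁ : η < 1 / 2 := by
    have := min_le_left (1 / 2 : ℝ) (K / (32 * C)); rw [hη_def]; linarith
  have hη₂ : η < K / (32 * C) := by
    have := min_le_right (1 / 2 : ℝ) (K / (32 * C)); rw [hη_def]; linarith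
  have hη₃ : 32 * C * η < K := by rwa [lt_div_iff₀ (by positivity), mul_comm] at hη₂
  set a₀ : ℝ := cLP / (4 * η) with ha₀_def
  have ha₀ : 0 < a₀ := by positivity
  set y : ℝ := c * a₀ with hy_def
  have hy : 0 < y := by positivity
  have hy2 : y ^ 2 = K / (16 * η ^ 2) := by
    rw [hy_def, ha₀_def, hK_def]; field_simp; ring
  -- e^{-y} y² ≤ 2
  have hexp : Real.exp (-y) * y ^ 2 ≤ 2 := by
    have h2 : y ^ 2 ≤ 2 * Real.exp y := by
      have := Real.pow_div_factorial_le_exp y hy.le 2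
      norm_num [Nat.factorial] at this
      linarith
    calc Real.exp (-y) * y ^ 2 ≤ Real.exp (-y) * (2 * Real.exp y) :=
          mul_le_mul_of_nonneg_left h2 (Real.exp_pos _).le
      _ = 2 := by rw [mul_left_comm, ← Real.exp_add]; simp
  have hfloor : C * Real.exp (-y) < η := by
    have hy2pos : 0 < y ^ 2 := by positivity
    have e1 : η * y ^ 2 = K / (16 * η) := by rw [hy2]; field_simp
    refine lt_of_mul_lt_mul_right ?_ hy2pos.le
    calc C * Real.exp (-y) * y ^ 2 = C * (Real.exp (-y) * y ^ 2) := by ring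
      _ ≤ C * 2 := mul_le_mul_of_nonneg_left hexp hC.le
      _ < η * y ^ 2 := by rw [e1, lt_div_iff₀ (by positivity)]; nlinarith
  refine ⟨a₀, 2 * η, η / 2, 2 * η, 3 * η, ha₀, by positivity, ?_, ?_, by linarith, by linarith, ?_⟩
  · rw [hy_def] at hfloor; linarith
  · rw [hη_def, lt_div_iff₀ (by linarith)]; nlinarith
  · rw [ha₀_def, div_div_eq_mul_div, lt_div_iff₀ hcLP]; nlinarith

/-- **SPECIMEN (the literal rational tuple of the order of record, at PLACEHOLDER constants).** IF the printed
constants were `ηA = 1/16`, `δ_ABL(ηV) = η₀ = ηZ = 1/100`, `C_R = 1/4`, `c_R = 1`, THEN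
`(a₀, ηV, Δ′, κ₀, U, ε, ε₁, σ, δ, η′) = (1, 1/16, 1001/1000, 1, 1/500, 1/1600, 1/100, 1/100, 1/200, 3/400)`
satisfies every row (`norm_num`; the single transcendental fact used is `e^{−1} < 1`). The constants are NOT
the printed ones (those are not numerals in print, see the module doc); the parametric statement is
`omegaWindow_nonempty`. [cite: AssingBlomerLi2020, Proposition 4.1 p. 17] -/
theorem omegaAdmissible_specimen :
    OmegaAdmissible (1 / 16) (1 / 100) (1 / 100) (1 / 100) (1 / 4) 1 1 (1 / 16) (1001 / 1000) 1
      (1 / 500) (1 / 1600) (1 / 100) (1 / 100) (1 / 200) (3 / 400) := by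
  have hexp : Real.exp (-1 : ℝ) < 1 := by
    rw [Real.exp_lt_one_iff]; norm_num
  constructor <;> norm_num
  · nlinarith [hexp, Real.exp_pos (-1 : ℝ)]

/-! ## V2 (2026-08-28, lead g9): the three Ω-f corrections of ls-ref-1 g17's G2 §(c) page price
(`G2C-PRICE-ABL-g17.md`, booked by ls-lead 11:24:02Z as PASS-WITH-CORRECTIONS)

N1: the `d₂/d₃` smooth shapes escape ABL's type-II window; their home is `FouvryTenenbaum2021_lemma413`
(`d₃` in progressions to moduli `x^{1/2+1/85}`, typed, proved modulo Deligne + Birch–Bombieri) ⇒ rows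
`η/2 + ε < 1/85` (our moduli `N^{1/2+η/2+ε}` inside its range) and «tiny-part loss below its saving `δ_FT`»
(booked like `saving`: the bulk enhancement plus losses below the printed power saving). N3: ABL Prop. 4.1
prints the prime-variable saving as `R^{−1/11}`, so the dispersion row reads `κ₀η + ε < δ/11` verbatim
(unless the weight `w(mn)` is Mellin-split; we book the verbatim, weaker form). N2 (modulus weights need a
Prop. 4.2-type sandwiched `γ`) is a SHAPE condition on the a8R input, not an exponent row. The window stays
NON-EMPTY: every added row is a positive threshold (`omegaWindowV2_nonempty`, witnesses `b = 1 + m/100`,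
`ε = m/200`, `m = min(δA, η₀, ηZ, δFT, 1/100)`; binding rows now `abl_saving11` and `ft_saving`). -/

/-- **OmegaAdmissible V2** = V1 plus the three Ω-f correction rows of the G2 §(c) page price (ls-ref-1 g17,
N1/N3): `ft_d3` (moduli inside Fouvry–Tenenbaum's `d₃` range `x^{1/2+1/85}`), `ft_saving` (bulk enhancement
plus losses below the `d₂/d₃`-in-AP power saving `δFT`), `abl_saving11` (ABL's printed prime-variable saving
`R^{−1/11}`: `κ₀η + ε < δ/11`). [cite: AssingBlomerLi2020, Proposition 4.1 p. 17 (saving R^{-1/11} in the prime variable)] -/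
structure OmegaAdmissibleV2 (ηA δA η₀ ηZ CR cR δFT a₀ ηV Δ' κ₀ U ε ε₁ σ δ η' : ℝ) : Prop
    extends OmegaAdmissible ηA δA η₀ ηZ CR cR a₀ ηV Δ' κ₀ U ε ε₁ σ δ η' where
  /-- N1: moduli `N^{1/2+η/2+ε}` inside the `d₃`-in-AP range `x^{1/2+1/85}` (`FouvryTenenbaum2021_lemma413`). -/
  ft_d3 : (Δ' - 1) / 2 + ε < 1 / 85
  /-- N1: bulk enhancement plus tiny-part losses below the `d₂/d₃`-in-AP power saving `δFT`. -/
  ft_saving : κ₀ * (Δ' - 1) + ε < δFT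
  /-- N3: ABL Prop. 4.1 verbatim — the prime-variable saving is `R^{−1/11}`, so `κ₀η + ε < δ/11`. -/
  abl_saving11 : κ₀ * (Δ' - 1) + ε < δ / 11

/-- **F2 V2: the corrected plan-Ω window is still NON-EMPTY**, same quantifier order as
`omegaWindow_nonempty` (that of `kernelExcessBelowSlack_io_of_blockAtCleanScales`), one more printed constant
`δFT > 0`. Witnesses: `ηV = min ηA 1/16`, `a₀ = 2C_R/c_R`, `m = min (min (min δA η₀) (min ηZ 1/100)) δFT`,
`b = 1 + m/100`; on the window `U = 2η`, `ε = m/200`, `ε₁ = σ = m`, `δ = m/2`, `η′ = 3m/4`.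
[cite: AssingBlomerLi2020, Proposition 4.1 p. 17; MontgomeryVaughan2007, Cor. 11.10 (Page)] -/
theorem omegaWindowV2_nonempty {ηA ηZ CR cR δFT : ℝ} (hηA : 0 < ηA) (hηZ : 0 < ηZ) (hCR : 0 < CR)
    (hcR : 0 < cR) (hδFT : 0 < δFT) {δABL : ℝ → ℝ}
    (hδABL : ∀ ηV : ℝ, 0 < ηV → ηV ≤ ηA → 0 < δABL ηV) :
    ∃ ηV : ℝ, 0 < ηV ∧ ηV ≤ ηA ∧ ∃ a₀ : ℝ, 0 < a₀ ∧ ∀ η₀ : ℝ, 0 < η₀ →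
      ∃ b : ℝ, 1 < b ∧ b < 2 ∧ ∀ Δ' : ℝ, 1 < Δ' → Δ' < b → ∀ κ₀ : ℝ, 1 / 2 ≤ κ₀ → κ₀ ≤ 1 →
        ∃ U ε ε₁ σ δ η' : ℝ,
          OmegaAdmissibleV2 ηA (δABL ηV) η₀ ηZ CR cR δFT a₀ ηV Δ' κ₀ U ε ε₁ σ δ η' := by
  set ηV : ℝ := min ηA (1 / 16) with hηV_def
  have hηV_pos : 0 < ηV := lt_min hηA (by norm_num)
  have hηV_le : ηV ≤ ηA := min_le_left _ _
  have hηV_16 : ηV ≤ 1 / 16 := min_le_right _ _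
  have hδA : 0 < δABL ηV := hδABL ηV hηV_pos hηV_le
  set a₀ : ℝ := 2 * CR / cR with ha₀_def
  have ha₀_pos : 0 < a₀ := by positivity
  have hdamp : CR * Real.exp (-(cR * a₀)) < 1 := by
    have hca : cR * a₀ = 2 * CR := by rw [ha₀_def]; field_simp
    rw [hca]
    have h1 : 2 * CR + 1 ≤ Real.exp (2 * CR) := by
      have := Real.add_one_le_exp (2 * CR); linarith
    have hprod : Real.exp (-(2 * CR)) * (2 * CR + 1) ≤ 1 := by
      calc Real.exp (-(2 * CR)) * (2 * CR + 1)
          ≤ Real.exp (-(2 * CR)) * Real.exp (2 * CR) :=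
            mul_le_mul_of_nonneg_left h1 (Real.exp_pos _).le
        _ = 1 := by rw [← Real.exp_add]; simp
    nlinarith [Real.exp_pos (-(2 * CR)), hprod, hCR]
  refine ⟨ηV, hηV_pos, hηV_le, a₀, ha₀_pos, fun η₀ hη₀ ↦ ?_⟩
  set m : ℝ := min (min (min (δABL ηV) η₀) (min ηZ (1 / 100))) δFT with hm_def
  have hm_pos : 0 < m := lt_min (lt_min (lt_min hδA hη₀) (lt_min hηZ (by norm_num))) hδFT
  have hm₁ : m ≤ min (min (δABL ηV) η₀) (min ηZ (1 / 100)) := min_le_left _ _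
  have hm_δFT : m ≤ δFT := min_le_right _ _
  have hm_δA : m ≤ δABL ηV := hm₁.trans ((min_le_left _ _).trans (min_le_left _ _))
  have hm_η₀ : m ≤ η₀ := hm₁.trans ((min_le_left _ _).trans (min_le_right _ _))
  have hm_ηZ : m ≤ ηZ := hm₁.trans ((min_le_right _ _).trans (min_le_left _ _))
  have hm_100 : m ≤ 1 / 100 := hm₁.trans ((min_le_right _ _).trans (min_le_right _ _))
  refine ⟨1 + m / 100, by linarith, by linarith, fun Δ' h1 h2 κ₀ hκ₁ hκ₂ ↦ ?_⟩
  have hη : 0 < Δ' - 1 := by linarith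
  have hηm : Δ' - 1 < m / 100 := by linarith
  have hκη : κ₀ * (Δ' - 1) ≤ Δ' - 1 := by nlinarith
  have hκη' : κ₀ * (Δ' - 1) + m / 200 < 3 * m / 200 := by linarith
  refine ⟨2 * (Δ' - 1), m / 200, m, m, m / 2, 3 * m / 4, ?_, ?_, ?_, ?_⟩
  · constructor
    · exact h1
    · linarith
    · rw [lt_div_iff₀ (by linarith)]; linarith
    · exact ha₀_pos
    · rw [lt_div_iff₀ (by linarith)]; nlinarith
    · have := mul_lt_mul_of_pos_left (show CR * Real.exp (-(cR * a₀)) < 2 by linarith) hη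
      linarith
    · positivity
    · linarith
    · linarith
    · linarith
    · positivity
    · linarith
    · linarith
    · positivity
    · linarith
    · linarith
    · linarith
    · exact hηV_pos
    · exact hηV_le
    · linarith
    · positivity
    · linarith
    · linarith
    · linarith
  · linarith
  · linarith
  · linarith

end Summit.Parity.GeneralizedHardyLittlewood.Theorems.BeyondDiagonalBeatsQuarter
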